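import Summits.BirchSwinnertonDyer.BirchSwinnertonDyer.Theorems.GenusKolyvaginAtTwoGenusPrimitiveSupplyAtTwoArchimedeanRowsHold
import Summits.BirchSwinnertonDyer.BirchSwinnertonDyer.Theorems.GenusKolyvaginAtTwoGenusPrimitiveSupplyAtTwoArchimedeanEgg
import Summits.BirchSwinnertonDyer.Rank1Residual.F1Sign2.CasselsTateSignAtTwo
import Literature.NumberTheory.EllipticCurves.BSDRootNumberSmallConductorProofs
import Literature.NumberTheory.EllipticCurves.TwoAdicImageQuadraticTwistProofs
import HarnessLib.Audit.Tags
import HarnessLib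

/-!
# Cell `bsd-f1-sign2`, descent lens (planner `-desc` g19, MEMO-desc §27): «Ш[2] IN THE DOOR» — archimedean doors on the fkl residue
# (D-desc-69 port; FIVE KERNEL theorems E/R/L/X/Y + BSD₂ candidate rows T/T♯/S/A/CT (+ REF1's S′/CT′) as `@[conjecture]` defs)

PORT (cell `bsd-f1-sign2`, seat `-ty` g13, ask D-desc-69, INBOX 2026-08-28T21:56:21Z) of -desc g19's
`HOME/MEMO-desc-data/g19/lean/SketchG19DoorVisibility.lean` (sha16 8de8ae414688ce8e; MEMO-desc §27 «Ш[2] IN THE DOOR», HOME/MEMO-desc.md l.2103–2223, memo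
sha16 47fc79aa0f32146a; STATUS 2026-08-28T21:55:50Z; BC7 probe `ProbeG19.lean` 6852b6cc67e164d9 5/5 CLEAN; census kit j317979 `desc27-full`,
2 882 curves / 10 448 door rows, two engines per quantity, 0 violations on 10 pre-registered checks).  Bodies VERBATIM from the sketch, in the
sketch's order; the typer's only edits are this header, the import of `HarnessLib`, docstrings on the five `_holds` theorems (gate lint), the cite key `Cassels1962IV` → `Cassels1962ArithmeticIV` (ledger key), `@[conjecture]` on the five candidate rows (REF1 §146 (ii)) with REF1/REF2 riders in their docstrings, and the two typer blocks at the end (bridge `shaTwoCard W ∣ #Ш(W)[2^∞]`, -desc's rider ask; REF1 §146 riders T♯ ⇒ T, S′, CT′ from Probe146).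
CONTENT.  On the fkl residue `OnResidueAtTwo W` (:≡ `Δ_W > 0 ∧ NoRationalTwoTorsion W ∧ rank 1 ∧ #Ш(W)[2] = 4 ∧ MeetsEgg W`) every ARCHIMEDEAN door
twin `W^{(d)}` (`DescAdmissible W d`) has `Sel₂(W^{(d)}) = ker(loc_∞ | Sel₂(W)) ≅ Ш(W)[2]`.  KERNEL (proved in this file, std axioms):
**E `eggDoorDownLawAtTwo_holds`** (`0 < Δ → MeetsEgg → ∀ d, DescAdmissible → 2·#Sel₂(W^d) = #Sel₂(W)` — the tree's `eggTwistLawAtTwo_holds` WITHOUT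
`ShaTwoTrivial`, from `GenusKolyArch.two_mul_twistSelmerTwoCard_eq_of_exists_unconditional` + `exists_mem_selmerGroup_localization_inl_ne_zero_of_meetsEgg`),
**R `residueDoorSelmerFourAtTwo_holds`** (`#Sel₂(W^d) = 4` on the residue), **L `residueDoorRankLeTwoAtTwo_holds`** (rank `W^d ≤ 2`),
**X `residueDoorShaTwoTransportCardAtTwo_holds`** (rank-0 twin ⇒ `#Ш(W^d)[2] = 4`: TRANSPORT), **Y `residueDoorShaTwoDissolvedCardAtTwo_holds`**
(rank-2 twin ⇒ `Ш(W^d)[2] = 0`: DISSOLUTION); helper `selmerTwoCard_eq_eight_of_residue`.  TYPED BSD₂ CANDIDATES (`@[conjecture] def`s per REF1 §146 (ii), nothing asserted;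
BSD₂-predicted, census j317979): T `ResidueDoorVisibleFourAtTwo` (rank-0 door twin ⇒ `4 ∣ #Ш_an(W^d)`: «visible factor 4 of L(W^d,1)», Agashe-type
at p = 2 where print excludes 2; census 3 746/3 746), T♯ `ResidueDoorVisibleFourSharpAtTwo` (θ-dichotomy v₂ = 2 or ≥ 4; 2 298 + 1 448), S
`ResidueDoorDissolvedOddAtTwo` (rank-2 twin ⇒ `#Ш_an` odd; 1 344/1 344), A `ResidueDoorAnalyticRankDichotomyAtTwo` (r_an(W^d) ∈ {0, 2}), CT
`ResidueCasselsTateBitAtTwo` (on the whole residue: v₂ #Ш_an(W) = 2 if the Cassels–Tate form on Ш(W)[2] is non-degenerate, ≥ 4 if it vanishes;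
census P9; NOTE (-desc): the TRANSPORT of the Cassels–Tate bit to the door twin is REFUTED AS A LAW by 380973b1 (Ш_an(W) = 16, seven rank-0 doors
with Ш_an(W^d) = 4) — that transported law is NOT typed here; recorded negative, do not staff).  Helper defs `shaTwoCard W :=
Nat.card ↥(W.sha ⊓ AddSubgroup.torsionBy W.galH1 2)` (the descent-count currency of `card_selmerGroup_eq_pow_rank_mul` and of `ShaTwoTrivial`;
the `2`-primary currency `AddCommGroup.primaryComponent W.sha 2` of `SquareLawAtTwo`/`KummerEntanglementAtTwo` is Ш[2^∞] ⊇ Ш[2]) and `OnResidueAtTwo`.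
REF1 §146 = D-desc-70 (refuter-bsd-f1-sign2-ref1 g13, `HOME/REF1-AUDIT-v1.md` l.2819; evidence `HOME/REF1-data/b146/` — `lean/Probe146.lean` 8ef3bf87dd58630e
= the sketch verbatim + probes ×5, J1–J6 std axioms, farm rc 0; INBOX 2026-08-28T22:38:05Z) ONE LINE verbatim: «D-desc-70 DONE = REF1 §146: audit of
`MEMO-desc-data/g19/lean/SketchG19DoorVisibility.lean` 8de8ae414688ce8e — PROVED rows E/R/L/X/Y re-checked kernel-closed from this seat; candidate rows
T/T♯/S/A/CT all SURVIVE AS TYPED, 0 killed, all CONJECTURE-GRADE BSD-slices (T = BSD₂ of the rank-0 twin ≥ 2², T♯ = to 2⁴ with the θ-split exactly right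
under finiteness via Cassels M×M, S = rank conjecture at r_an = 2 + BSD₂, A = «r_an ≤ 2» BSD-rank-grade with the parity half theorem-grade, CT = BSD₂(W)
θ-dichotomy); helper defs `shaTwoCard`/`OnResidueAtTwo` junk-free; habitat inhabited in nature (681 RESP/egg curves, e.g. 27262b1, 32291a1)» — -ty
instructions APPLIED: (i) E/R/L/X/Y filed as they stand; (ii) T/T♯/S/A/CT tagged `@[conjecture]` (conjecture-class; the planner asked for plain defs,
REF1's gate ruling wins); kernel one-liner `t_of_tSharp : T♯ → T` (Probe146 J3) so T is not an independent conjecture; (iii) REF1's PREFERRED BODIES typed in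
addition to the planner's: S′ `ResidueDoorDissolvedOddAtTwoMW` (= S + binder `Wd.mordellWeilRank = 2`) with `dissolvedOddMW_of_dissolvedOdd : S → S′`, and CT′
`ResidueCasselsTateBitAtTwoAnalyticRankOne` (= CT + binder `W.analyticRank = 1`; name by the typer) with `casselsTateBitAnalyticRankOne_of_casselsTateBit :
CT → CT′`; S and CT carry REF1's «includes the rank conjecture / the converse» marks; (iv) the «pre-refuted by 380973b1» sentence is scoped to θ-TRANSPORT.
REF2 v41 §2 (refuter-bsd-f1-sign2-ref2 g41, `HOME/REF2-PLACEMENT-v41.md` 00028fe2f0cecc0c, INBOX 2026-08-28T22:25:05Z; header text §2.4 verbatim): «PLACEMENT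
(REF2 v41 §2): mechanism = Kramer 1981 Prop. 6 (i_∞ = 1: the Kummer lines of W and W^{(d)} at ∞ are transversal) + Thm 1; Mazur–Rubin 2010 Lemma 2.9–2.11,
Prop. 3.3, Cor. 3.4 with T = {∞}; Poitou–Tate (tree `two_mul_twistSelmerTwoCard_eq_of_exists_unconditional`). Rows E/R/L/X/Y: known mechanism, kernel-proved
here (E = the tree's `EggTwistLawAtTwo` with the rank-1 and `ShaTwoTrivial` hypotheses removed). Candidates T/T♯ (visible factor 4 of Ш_an at a rank-0 door
twin): not in print at p = 2 — visibility ⇒ L-value factor is printed for odd primes only [cite: Agashe2010]; nearest 2-adic twist-value laws [cite: Zhai2016,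
Thm. 1.1, Thm. 1.2] (rank-0 base, E(ℚ)[2] = 0, a_q odd) and Cai–Li–Zhai 2020 (E(ℚ)[2] = ℤ/2, excluded here); S, A conjecture-grade; CT typed as the W-side
dichotomy only (the transported CT law is refuted by 380973b1, MEMO-desc §27.3). [cite: Kramer1981, Prop. 6, Thm. 1] [cite: MazurRubin2010, Lemma 2.9, Prop.
3.3, Cor. 3.4] [cite: Bruin2004, Thm. 1.2] [cite: CremonaMazur2000] [cite: Agashe2010] [cite: Zhai2016, Thm. 1.1, Thm. 1.2]»; grade T/T♯ NEW-COMBINATION,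
conjecture-grade; crux idea `sha-two-in-the-door-at-two` KEEP, novelty new-combination; no refuted-in-print statement among E/R/L/X/Y/T/T♯/S/A.
PARTITION: fkl residue of 23715 (R₊₊ ∩ Δ_W > 0) and gk2 residual 24883 (door twins W^d have conductor N d² outside the desks' ranges — desk numbers
untouched); beyond-print theorem: no (E/R/L/X/Y are kernel-closed elementary consequences of tree theorems + Kramer/MR bookkeeping; T/S are
BSD₂-predicted candidates with census); BSD not proved; no item closed; bears_on: stmt-BirchSwinnertonDyer-23715, stmt-BirchSwinnertonDyer-24883.

## The sketch's own summary (verbatim)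

# Sketch (cell bsd-f1-sign2, LENS desc, g19): §27 «Ш[2] IN THE DOOR» — archimedean doors on the fkl residue

Typed rows DESC-27-E/R (PROVED here), DESC-27-L (PROVED: rank bound), DESC-27-X/Y (PROVED: the TRANSPORT / DISSOLUTION
dichotomy in cardinal form — a rank-0 door twin has `#Ш[2] = 4`, a rank-2 door twin has `Ш[2] = 0`), and the BSD₂ candidate rows
DESC-27-T («visible factor 4»), DESC-27-S (dissolution ⇒ odd `Ш_an`), DESC-27-A (analytic rank dichotomy), DESC-27-CT (Cassels–Tate
bit on the residue ⇒ `2⁴ ∣ Ш_an`).  Nothing here is filed; `-ty` files by name.  BSD is not proved by any of this.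
-/

namespace Summit.BirchSwinnertonDyer.Rank1Residual.F1Sign2

open WeierstrassCurve Literature.NumberTheory.EllipticCurves
open Summit.BirchSwinnertonDyer.BirchSwinnertonDyer.Theorems.GenusKolyArch

set_option autoImplicit false

noncomputable section

/-- `#Ш(W)[2]` (the factor of the descent count `card_selmerGroup_eq_pow_rank_mul`). -/
def shaTwoCard (W : WeierstrassCurve ℚ) : ℕ :=
  Nat.card (W.sha ⊓ AddSubgroup.torsionBy W.galH1 (2 : ℕ) : AddSubgroup W.galH1)

/-- The **fkl residue at an archimedean door**: `Δ_W > 0`, `E(ℚ)[2] = 0`, rank one, `Ш(W)[2] ≅ (ℤ/2)²`, and `E(ℚ)` meets the egg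
(`ε(W) = +1`; on this stratum `⇔` the generator's Kummer class is non-trivial at `∞`). -/
def OnResidueAtTwo (W : WeierstrassCurve ℚ) [W.IsGloballyMinimal] : Prop :=
  0 < W.Δ ∧ NoRationalTwoTorsion W ∧ W.mordellWeilRank = 1 ∧ shaTwoCard W = 4 ∧ MeetsEgg W

/-- **DESC-27-E `EggDoorDownLawAtTwo` (THEOREM, hypothesis-free DOWN).** For every globally minimal elliptic `W/ℚ` with `Δ_W > 0`
whose Mordell–Weil group meets the egg, EVERY descent-admissible twist halves `#Sel₂`: `2·#Sel₂(W^{(d)}) = #Sel₂(W)` — no hypothesis on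
rank, torsion or `Ш` (T-C `EggTwistLawAtTwo` needed rank `1` and `Ш[2] = 0`).  Mechanism: `Sel₂(W^{(d)}) = ker(loc_∞ | Sel₂(W))` and `κ(P)`,
`P` on the egg, is not in the kernel. [cite: Kramer1981, §2 Prop. 6, Thm. 1] [cite: MazurRubin2010, Cor. 3.4 (i)] -/
def EggDoorDownLawAtTwo : Prop :=
  ∀ (W : WeierstrassCurve ℚ) [W.IsElliptic] [W.IsGloballyMinimal], 0 < W.Δ → MeetsEgg W →
    ∀ d : ℤ, DescAdmissible W d → 2 * twistSelmerTwoCard W d = selmerTwoCard W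

/-- **DESC-27-E HOLDS** (kernel; -desc g19): `two_mul_twistSelmerTwoCard_eq_of_exists_unconditional` ∘ `exists_mem_selmerGroup_localization_inl_ne_zero_of_meetsEgg`. -/
theorem eggDoorDownLawAtTwo_holds : EggDoorDownLawAtTwo := fun W _ _ hΔ hegg _ hd ↦
  two_mul_twistSelmerTwoCard_eq_of_exists_unconditional W hΔ
    (exists_mem_selmerGroup_localization_inl_ne_zero_of_meetsEgg W hegg) hd

/-- Descent count on the residue: `#Sel₂(W) = 2¹ · 1 · 4 = 8`. -/
theorem selmerTwoCard_eq_eight_of_residue (W : WeierstrassCurve ℚ) [W.IsElliptic] [W.IsGloballyMinimal]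
    (h : OnResidueAtTwo W) : selmerTwoCard W = 8 := by
  obtain ⟨_, hT, hrank, hsha, _⟩ := h
  have hinst : (instDecidableEqRat : DecidableEq ℚ) = fun a b => Classical.propDecidable (a = b) := Subsingleton.elim _ _
  have ht : Nat.card (AddSubgroup.torsionBy W.toAffine.Point ((2 : ℕ) : ℤ)) = 1 := by
    have hbot : AddSubgroup.torsionBy W.toAffine.Point ((2 : ℕ) : ℤ) = ⊥ :=
      (AddSubgroup.eq_bot_iff_forall _).mpr fun P hP ↦
        EggDoubling.eq_zero_of_two_smul_eq_zero W hT P (AddSubgroup.torsionBy.nsmul_iff.mp hP)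
    rw [hbot, AddSubgroup.card_bot]
  rw [hinst] at ht
  have h := card_selmerGroup_eq_pow_rank_mul W 2
  unfold shaTwoCard at hsha
  rw [ht, hsha, hrank, mul_one, pow_one, Nat.cast_ofNat] at h
  exact h

/-- **DESC-27-R `ResidueDoorSelmerFourAtTwo` (THEOREM).** On the residue every descent-admissible twist has `#Sel₂(W^{(d)}) = 4`
(`= #Ш(W)[2]`: the twist's `2`-Selmer group IS `Ш(W)[2]`, transported along `H¹(ℚ, W^{(d)}[2]) = H¹(ℚ, W[2])`). -/
def ResidueDoorSelmerFourAtTwo : Prop :=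
  ∀ (W : WeierstrassCurve ℚ) [W.IsElliptic] [W.IsGloballyMinimal], OnResidueAtTwo W →
    ∀ d : ℤ, DescAdmissible W d → twistSelmerTwoCard W d = 4

/-- **DESC-27-R HOLDS** (kernel; -desc g19): `#Sel₂(W) = 8` on the residue and the DOWN law E. -/
theorem residueDoorSelmerFourAtTwo_holds : ResidueDoorSelmerFourAtTwo := fun W _ _ h d hd ↦ by
  have h8 := selmerTwoCard_eq_eight_of_residue W h
  have h2 := eggDoorDownLawAtTwo_holds W h.1 h.2.2.2.2 d hd
  omega

/-- **DESC-27-T `ResidueDoorVisibleFourAtTwo` (BSD₂ candidate: the TRANSPORTED `Ш(W)[2]` as a «visible factor 4» of `L(W^{(d)},1)`).**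
On the residue, at a descent-admissible door `d` whose twist has `L(W^{(d)},1) ≠ 0`: `#Ш_an(W^{(d)})` is a rational number of `2`-adic
valuation `≥ 2`.  Algebraic side PROVED in print-assembly (Kolyvagin: rank `W^{(d)} = 0`; DESC-27-R: `#Sel₂ = 4`; `E^{(d)}(ℚ)[2] = 0` ⇒
`Ш(W^{(d)})[2] ≅ (ℤ/2)²`, `= Ш(W)[2]` as a subgroup of `H¹(ℚ, W[2])`); the row is the `2`-part of BSD for the twin down to `2²`.
Census §27 (P3).
REF1 §146: SURVIVES AS TYPED, CONJECTURE-GRADE (= BSD₂ of the rank-0 twin down to 2²; the `∃ q : ℚ` rationality clause is print at rank 0); T♯ ⇒ T is the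
kernel one-liner `t_of_tSharp` below (REF1 Probe146 J3), so T is not an independent conjecture.  REF2 v41 §2: NOT IN PRINT at p = 2 for quadratic twists
(visibility ⇒ L-value factor is printed for odd primes only [cite: Agashe2010]; nearest 2-adic twist-value laws [cite: Zhai2016, Thm. 1.1, Thm. 1.2] have a
rank-0 base); NEW-COMBINATION; beyond-print no. [cite: Kramer1981, Thm. 1] [cite: CremonaMazur2000, §3] [cite: Miller2011LMS, Def. 1.1] -/
@[conjecture] def ResidueDoorVisibleFourAtTwo : Prop :=
  ∀ (W : WeierstrassCurve ℚ) [W.IsElliptic] [W.IsGloballyMinimal], OnResidueAtTwo W →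
    ∀ d : ℤ, DescAdmissible W d → (W.quadraticTwist (d : ℚ)).entireLFunction 1 ≠ 0 →
      ∀ (Wd : WeierstrassCurve ℚ) [Wd.IsElliptic] [Wd.IsGloballyMinimal] (Cd : WeierstrassCurve.VariableChange ℚ),
        Cd • W.quadraticTwist (d : ℚ) = Wd →
          ∃ q : ℚ, shaAn Wd = (q : ℂ) ∧ 2 ≤ padicValRat 2 q

/-- **DESC-27-T♯ `ResidueDoorVisibleFourSharpAtTwo` (BSD₂ + Cassels–Tate refinement).** Same habitat; if moreover the Cassels–Tate form on
`Sel₂(W^{(d)}) = Ш(W^{(d)})[2]` is non-degenerate (`θ(W^{(d)}) = −1`, tree `¬ ShaTwoInTwiceShaFour`) then `v₂(#Ш_an(W^{(d)})) = 2` exactly;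
if it vanishes (`θ = +1`) then `v₂ ≥ 4`. Census §27 (P3a/P3b).
REF1 §146: SURVIVES AS TYPED, CONJECTURE-GRADE (BSD₂ of the rank-0 twin to 2⁴; the θ-split is exactly right under finiteness via Cassels' M × M).
[cite: Cassels1962ArithmeticIV, Thm. 1.1] [cite: Fisher2022quartics, Thm. 3.1] -/
@[conjecture] def ResidueDoorVisibleFourSharpAtTwo : Prop :=
  ∀ (W : WeierstrassCurve ℚ) [W.IsElliptic] [W.IsGloballyMinimal], OnResidueAtTwo W →
    ∀ d : ℤ, DescAdmissible W d → (W.quadraticTwist (d : ℚ)).entireLFunction 1 ≠ 0 →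
      ∀ (Wd : WeierstrassCurve ℚ) [Wd.IsElliptic] [Wd.IsGloballyMinimal] (Cd : WeierstrassCurve.VariableChange ℚ),
        Cd • W.quadraticTwist (d : ℚ) = Wd →
          ∃ q : ℚ, shaAn Wd = (q : ℂ) ∧
            (¬ ShaTwoInTwiceShaFour Wd → padicValRat 2 q = 2) ∧ (ShaTwoInTwiceShaFour Wd → 4 ≤ padicValRat 2 q)

/-- **DESC-27-S `ResidueDoorDissolvedOddAtTwo` (BSD₂ candidate: DISSOLUTION).** On the residue, at a descent-admissible door whose twist
has analytic rank `2`, `#Ш_an(W^{(d)})` is a rational number of `2`-adic valuation `0` (the regulator of the twin is `2`-saturated and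
`Ш(W^{(d)})[2] = 0`: all of `Ш(W)[2]` has become Mordell–Weil of `W^{(d)}`, i.e. of `Res_{K_d/ℚ} W`). Census §27 (P4).
REF1 §146: SURVIVES AS TYPED, CONJECTURE-GRADE in BOTH clauses — as typed (binder `Wd.analyticRank = 2` only) the row INCLUDES the rank conjecture at
`r_an = 2` («r_an = 2 ⇒ r_MW = 2», because `shaAn` divides by the regulator of the Mordell–Weil group whatever its rank; census P4 tested r_MW = r_an = 2
twins); REF1's preferred body S′ `ResidueDoorDissolvedOddAtTwoMW` (extra binder `Wd.mordellWeilRank = 2`) is filed below with the kernel one-liner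
`dissolvedOddMW_of_dissolvedOdd : S → S′`.  REF2 v41 §2: conjecture-grade, no print (analytic rank 2 has no GZK; the algebraic half Y is kernel).
[cite: CremonaMazur2000, §3] [cite: Bruin2004, Thm. 1.2] -/
@[conjecture] def ResidueDoorDissolvedOddAtTwo : Prop :=
  ∀ (W : WeierstrassCurve ℚ) [W.IsElliptic] [W.IsGloballyMinimal], OnResidueAtTwo W →
    ∀ d : ℤ, DescAdmissible W d →
      ∀ (Wd : WeierstrassCurve ℚ) [Wd.IsElliptic] [Wd.IsGloballyMinimal] (Cd : WeierstrassCurve.VariableChange ℚ),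
        Cd • W.quadraticTwist (d : ℚ) = Wd → Wd.analyticRank = 2 →
          ∃ q : ℚ, shaAn Wd = (q : ℂ) ∧ padicValRat 2 q = 0

/-- **DESC-27-L `ResidueDoorRankLeTwoAtTwo` (THEOREM-grade: `2^{rank} ∣ #Sel₂ = 4`).** On the residue every descent-admissible twist has
Mordell–Weil rank `≤ 2`. -/
def ResidueDoorRankLeTwoAtTwo : Prop :=
  ∀ (W : WeierstrassCurve ℚ) [W.IsElliptic] [W.IsGloballyMinimal], OnResidueAtTwo W →
    ∀ d : ℤ, DescAdmissible W d → (W.quadraticTwist (d : ℚ)).mordellWeilRank ≤ 2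

/-- **DESC-27-L HOLDS** (kernel; -desc g19): `2^{rank} ∣ #Sel₂(W^d) = 4`. -/
theorem residueDoorRankLeTwoAtTwo_holds : ResidueDoorRankLeTwoAtTwo := fun W _ _ h d hd ↦ by
  have h4 := residueDoorSelmerFourAtTwo_holds W h d hd
  have hd0 : (d : ℚ) ≠ 0 := by exact_mod_cast (ne_of_lt hd.1)
  haveI := W.isElliptic_quadraticTwist hd0
  have hc := card_selmerGroup_eq_pow_rank_mul (W.quadraticTwist (d : ℚ)) 2
  unfold twistSelmerTwoCard at h4
  rw [Nat.cast_ofNat] at hc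
  rw [hc] at h4
  -- `2 ^ r * a * b = 4` forces `2 ^ r ∣ 4`, hence `r ≤ 2`
  set r := (W.quadraticTwist (d : ℚ)).mordellWeilRank with hr
  have hdvd : 2 ^ r ∣ 4 := ⟨_, by rw [← h4, mul_assoc]⟩
  have hle : 2 ^ r ≤ 2 ^ 2 := Nat.le_of_dvd (by norm_num) hdvd
  exact (Nat.pow_le_pow_iff_right (by norm_num)).mp hle

/-- **DESC-27-X `ResidueDoorShaTwoTransportCardAtTwo` (THEOREM-grade; TRANSPORT in cardinal form).** On the residue, at a descent-admissible door whose
twist has Mordell–Weil rank `0` (Kolyvagin at an `L(W^{(d)},1) ≠ 0` door), `#Ш(W^{(d)})[2] = 4 = #Ш(W)[2]` — the twin carries a copy of the residue's `Ш[2]`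
(the twist model `W.quadraticTwist d` is used directly; `Ш` and rank are model-invariant). -/
def ResidueDoorShaTwoTransportCardAtTwo : Prop :=
  ∀ (W : WeierstrassCurve ℚ) [W.IsElliptic] [W.IsGloballyMinimal], OnResidueAtTwo W →
    ∀ d : ℤ, DescAdmissible W d → (W.quadraticTwist (d : ℚ)).mordellWeilRank = 0 →
      shaTwoCard (W.quadraticTwist (d : ℚ)) = 4

/-- **DESC-27-X HOLDS** (kernel; -desc g19): TRANSPORT — rank-0 twin ⇒ `#Ш(W^d)[2] = 4` by the descent count with `W^d(ℚ)[2] = 0`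
(`forall_two_nsmul_quadraticTwist_iff`). -/
theorem residueDoorShaTwoTransportCardAtTwo_holds : ResidueDoorShaTwoTransportCardAtTwo := fun W _ _ h d hd hr0 ↦ by
  have h4 := residueDoorSelmerFourAtTwo_holds W h d hd
  have hd0 : (d : ℚ) ≠ 0 := by exact_mod_cast (ne_of_lt hd.1)
  haveI := W.isElliptic_quadraticTwist hd0
  have hT1 : ∀ P : W.toAffine.Point, 2 • P = 0 → P = 0 :=
    fun P hP ↦ EggDoubling.eq_zero_of_two_smul_eq_zero W h.2.1 P hP
  have hT2 : ∀ P : (W.quadraticTwist (d : ℚ)).toAffine.Point, 2 • P = 0 → P = 0 :=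
    (forall_two_nsmul_quadraticTwist_iff W hd0).mpr hT1
  have hinst : (instDecidableEqRat : DecidableEq ℚ) = fun a b => Classical.propDecidable (a = b) := Subsingleton.elim _ _
  have ht : Nat.card (AddSubgroup.torsionBy (W.quadraticTwist (d : ℚ)).toAffine.Point ((2 : ℕ) : ℤ)) = 1 := by
    have hbot : AddSubgroup.torsionBy (W.quadraticTwist (d : ℚ)).toAffine.Point ((2 : ℕ) : ℤ) = ⊥ :=
      (AddSubgroup.eq_bot_iff_forall _).mpr fun P hP ↦ hT2 P (AddSubgroup.torsionBy.nsmul_iff.mp hP)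
    rw [hbot, AddSubgroup.card_bot]
  rw [hinst] at ht
  have hc := card_selmerGroup_eq_pow_rank_mul (W.quadraticTwist (d : ℚ)) 2
  rw [ht, hr0, pow_zero, one_mul, one_mul, Nat.cast_ofNat] at hc
  unfold twistSelmerTwoCard at h4
  rw [hc] at h4
  exact h4

/-- **DESC-27-Y `ResidueDoorShaTwoDissolvedCardAtTwo` (THEOREM-grade; DISSOLUTION in cardinal form).** On the residue, at a descent-admissible door whose
twist has Mordell–Weil rank `2`, `Ш(W^{(d)})[2] = 0`: the whole transported plane is Mordell–Weil of the twin (all of `Ш(W)[2]` is visible in `Res_{K_d/ℚ} W`). -/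
def ResidueDoorShaTwoDissolvedCardAtTwo : Prop :=
  ∀ (W : WeierstrassCurve ℚ) [W.IsElliptic] [W.IsGloballyMinimal], OnResidueAtTwo W →
    ∀ d : ℤ, DescAdmissible W d → (W.quadraticTwist (d : ℚ)).mordellWeilRank = 2 →
      shaTwoCard (W.quadraticTwist (d : ℚ)) = 1

/-- **DESC-27-Y HOLDS** (kernel; -desc g19): DISSOLUTION — rank-2 twin ⇒ `#Ш(W^d)[2] = 1` by the descent count. -/
theorem residueDoorShaTwoDissolvedCardAtTwo_holds : ResidueDoorShaTwoDissolvedCardAtTwo := fun W _ _ h d hd hr2 ↦ by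
  have h4 := residueDoorSelmerFourAtTwo_holds W h d hd
  have hd0 : (d : ℚ) ≠ 0 := by exact_mod_cast (ne_of_lt hd.1)
  haveI := W.isElliptic_quadraticTwist hd0
  have hT1 : ∀ P : W.toAffine.Point, 2 • P = 0 → P = 0 :=
    fun P hP ↦ EggDoubling.eq_zero_of_two_smul_eq_zero W h.2.1 P hP
  have hT2 : ∀ P : (W.quadraticTwist (d : ℚ)).toAffine.Point, 2 • P = 0 → P = 0 :=
    (forall_two_nsmul_quadraticTwist_iff W hd0).mpr hT1
  have hinst : (instDecidableEqRat : DecidableEq ℚ) = fun a b => Classical.propDecidable (a = b) := Subsingleton.elim _ _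
  have ht : Nat.card (AddSubgroup.torsionBy (W.quadraticTwist (d : ℚ)).toAffine.Point ((2 : ℕ) : ℤ)) = 1 := by
    have hbot : AddSubgroup.torsionBy (W.quadraticTwist (d : ℚ)).toAffine.Point ((2 : ℕ) : ℤ) = ⊥ :=
      (AddSubgroup.eq_bot_iff_forall _).mpr fun P hP ↦ hT2 P (AddSubgroup.torsionBy.nsmul_iff.mp hP)
    rw [hbot, AddSubgroup.card_bot]
  rw [hinst] at ht
  have hc := card_selmerGroup_eq_pow_rank_mul (W.quadraticTwist (d : ℚ)) 2
  rw [ht, hr2, mul_one, Nat.cast_ofNat] at hc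
  unfold twistSelmerTwoCard at h4
  rw [hc] at h4
  exact Nat.eq_of_mul_eq_mul_left (show 0 < 2 ^ 2 by norm_num) (h4.trans (by norm_num))

/-- **DESC-27-A `ResidueDoorAnalyticRankDichotomyAtTwo` (candidate; root number `+1` is known, `≤ 2` is the content).** On the residue the
twin at a descent-admissible door has analytic rank `0` or `2`. Census §27 (P2).
REF1 §146: SURVIVES, CONJECTURE-GRADE (BSD-rank-grade): content = «r_an(W^d) is even and ≤ 2» — evenness (root number `w(W)·χ_d(−N) = +1` of the
`t = s = 0` twin) is print-grade, «≤ 2» for the ANALYTIC rank is conjecture-grade (only `rank ≤ 2` is algebraic, row L).  REF2 v41 §2: same. -/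
@[conjecture] def ResidueDoorAnalyticRankDichotomyAtTwo : Prop :=
  ∀ (W : WeierstrassCurve ℚ) [W.IsElliptic] [W.IsGloballyMinimal], OnResidueAtTwo W →
    ∀ d : ℤ, DescAdmissible W d →
      ∀ (Wd : WeierstrassCurve ℚ) [Wd.IsElliptic] [Wd.IsGloballyMinimal] (Cd : WeierstrassCurve.VariableChange ℚ),
        Cd • W.quadraticTwist (d : ℚ) = Wd → Wd.analyticRank = 0 ∨ Wd.analyticRank = 2

/-- **DESC-27-CT `ResidueCasselsTateBitAtTwo` (BSD₂ candidate on the WHOLE residue, both signs of `Δ`: the lower half to `2⁴`).**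
Rank one, `E(ℚ)[2] = 0`, `Ш(W)[2] ≅ (ℤ/2)²`: `v₂(#Ш_an(W)) = 2` if the Cassels–Tate form on `Ш(W)[2]` is non-degenerate, `≥ 4` if it
vanishes. Census §27 (P9: PARI `ellrank` `[1,1,2]` on every `Ш_an = 4` curve, `[1,3,0]` on every `Ш_an = 16` curve).
REF1 §146: SURVIVES AS TYPED, CONJECTURE-GRADE (= BSD₂(W) exact-valuation dichotomy; census P9 ✓); as typed (binder `W.mordellWeilRank = 1`) the
rationality clause `∃ q, shaAn W = q` silently INCLUDES «r_MW = 1 ⇒ r_an = 1» (converse-grade); REF1's preferred body CT′ (extra binder `W.analyticRank = 1`,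
making the `∃ q` clause Gross–Zagier–Kolyvagin print) is filed below as `ResidueCasselsTateBitAtTwoAnalyticRankOne` with the kernel one-liner
`casselsTateBitAnalyticRankOne_of_casselsTateBit : CT → CT′`.  NOTE (REF1 (iv) / -desc §27.3): the sentence «pre-refuted as a law by 380973b1» concerns the
θ-TRANSPORT W ↦ W^d (NOT typed anywhere), not this W-side row.  REF2 v41 §2: census-consistent typed candidate; [cite: Fisher2022quartics, Thm. 3.1] is the
printed pairing formula PARI implements. [cite: Cassels1962ArithmeticIV, Thm. 1.1] -/
@[conjecture] def ResidueCasselsTateBitAtTwo : Prop :=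
  ∀ (W : WeierstrassCurve ℚ) [W.IsElliptic] [W.IsGloballyMinimal], NoRationalTwoTorsion W → W.mordellWeilRank = 1 →
    shaTwoCard W = 4 →
      ∃ q : ℚ, shaAn W = (q : ℂ) ∧
        (¬ ShaTwoInTwiceShaFour W → padicValRat 2 q = 2) ∧ (ShaTwoInTwiceShaFour W → 4 ≤ padicValRat 2 q)

/-! ### Typer addition (-ty g13; -desc g19's rider ask): bridge from the descent-count currency `shaTwoCard W = #Ш(W)[2]` to the `2`-primary
currency `AddCommGroup.primaryComponent W.sha 2 = Ш(W)[2^∞]` of `SquareLawAtTwo` / `KummerEntanglementAtTwo` / `TwoAdicBSDExactRankOneSsAtTwo` -/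

/-- The `2`-torsion of `Ш` embeds in its `2`-primary component `Ш[2^∞]`: the additive hom `c ↦ c`. -/
def shaTwoToPrimary (W : WeierstrassCurve ℚ) :
    (W.sha ⊓ AddSubgroup.torsionBy W.galH1 (2 : ℕ) : AddSubgroup W.galH1) →+ AddCommGroup.primaryComponent W.sha 2 where
  toFun c := ⟨⟨c.1, (AddSubgroup.mem_inf.mp c.2).1⟩, ⟨1, by
    have h2 : (2 : ℕ) • (c : W.galH1) = 0 := AddSubgroup.torsionBy.nsmul_iff.mp (AddSubgroup.mem_inf.mp c.2).2
    rw [pow_one]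
    exact Subtype.ext (by simpa using h2)⟩⟩
  map_zero' := by ext; rfl
  map_add' _ _ := by ext; rfl

/-- `shaTwoToPrimary` is injective (it is the identity on underlying classes). -/
theorem shaTwoToPrimary_injective (W : WeierstrassCurve ℚ) : Function.Injective (shaTwoToPrimary W) := by
  intro a b h
  have h' := congrArg (fun x : AddCommGroup.primaryComponent W.sha 2 => ((x : W.sha) : W.galH1)) h
  exact Subtype.ext h'

/-- Bridge: `#Ш(W)[2] ∣ #Ш(W)[2^∞]` whenever the latter is finite (Lagrange along `shaTwoToPrimary`). -/
theorem shaTwoCard_dvd_natCard_primaryComponent (W : WeierstrassCurve ℚ)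
    [Finite (AddCommGroup.primaryComponent W.sha 2)] :
    shaTwoCard W ∣ Nat.card (AddCommGroup.primaryComponent W.sha 2) :=
  AddSubgroup.card_dvd_of_injective (shaTwoToPrimary W) (shaTwoToPrimary_injective W)

/-- The rider -desc asked for: on the residue (`shaTwoCard W = 4`), `4 ∣ #Ш(W)[2^∞]` under finiteness. -/
theorem four_dvd_natCard_primaryComponent_of_shaTwoCard_eq_four (W : WeierstrassCurve ℚ)
    [Finite (AddCommGroup.primaryComponent W.sha 2)] (h : shaTwoCard W = 4) :
    4 ∣ Nat.card (AddCommGroup.primaryComponent W.sha 2) :=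
  h ▸ shaTwoCard_dvd_natCard_primaryComponent W

/-! ### REF1 §146 riders (typed VERBATIM from REF1 `Probe146.lean` 8ef3bf87dd58630e, ns there `…F1Sign2.REF1g13d`): T♯ ⇒ T glue, the preferred bodies
S′ / CT′ with their kernel weakenings from the planner's S / CT -/

/-- KERNEL glue (REF1 §146 J3): T♯ ⇒ T (both θ-branches give `v₂ ≥ 2`), so T is not an independent conjecture. -/
theorem t_of_tSharp : ResidueDoorVisibleFourSharpAtTwo → ResidueDoorVisibleFourAtTwo := by
  intro h W _ _ hW d hd hL Wd _ _ Cd hC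
  obtain ⟨q, hq, h1, h2⟩ := h W hW d hd hL Wd Cd hC
  refine ⟨q, hq, ?_⟩
  by_cases hs : ShaTwoInTwiceShaFour Wd
  · exact le_trans (by norm_num) (h2 hs)
  · exact (h1 hs).symm ▸ le_refl _

/-- **DESC-27-S′ `ResidueDoorDissolvedOddAtTwoMW` (REF1 §146 rider J4, REF1's PREFERRED BODY of S; conjecture-grade BSD₂ slice):** DESC-27-S with the
twin's Mordell–Weil rank made an explicit binder — isolates the `2`-part from the rank conjecture at `r_an = 2` (no converse theorem is known there;
`shaAn` divides by the regulator of the MW group whatever its rank).  Even so `∃ q : ℚ, shaAn Wd = q` stays BSD-grade (no Gross–Zagier formula in rank 2).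
[cite: CremonaMazur2000, §3] [cite: Bruin2004, Thm. 1.2] -/
@[conjecture] def ResidueDoorDissolvedOddAtTwoMW : Prop :=
  ∀ (W : WeierstrassCurve ℚ) [W.IsElliptic] [W.IsGloballyMinimal], OnResidueAtTwo W →
    ∀ d : ℤ, DescAdmissible W d →
      ∀ (Wd : WeierstrassCurve ℚ) [Wd.IsElliptic] [Wd.IsGloballyMinimal] (Cd : WeierstrassCurve.VariableChange ℚ),
        Cd • W.quadraticTwist (d : ℚ) = Wd → Wd.analyticRank = 2 → Wd.mordellWeilRank = 2 →
          ∃ q : ℚ, shaAn Wd = (q : ℂ) ∧ padicValRat 2 q = 0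

/-- KERNEL weakening (REF1 §146 J4): S ⇒ S′. -/
theorem dissolvedOddMW_of_dissolvedOdd : ResidueDoorDissolvedOddAtTwo → ResidueDoorDissolvedOddAtTwoMW :=
  fun h W _ _ hW d hd Wd _ _ Cd hC hr _ ↦ h W hW d hd Wd Cd hC hr

/-- **DESC-27-CT′ `ResidueCasselsTateBitAtTwoAnalyticRankOne` (REF1 §146 rider (iii), REF1's PREFERRED BODY of CT; conjecture-grade = pure BSD₂(W)):**
DESC-27-CT with the extra binder `W.analyticRank = 1`, which makes the rationality clause `∃ q : ℚ, shaAn W = q` PRINT (Gross–Zagier + Kolyvagin) so that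
the row is exactly the `2`-adic valuation dichotomy `v₂(#Ш_an(W)) = 2` (Cassels–Tate form on `Ш(W)[2]` non-degenerate) / `≥ 4` (it vanishes).  Name by the
typer (REF1 wrote «CT′ = CT + binder `W.analyticRank = 1 →`»). [cite: Cassels1962ArithmeticIV, Thm. 1.1] [cite: Fisher2022quartics, Thm. 3.1] -/
@[conjecture] def ResidueCasselsTateBitAtTwoAnalyticRankOne : Prop :=
  ∀ (W : WeierstrassCurve ℚ) [W.IsElliptic] [W.IsGloballyMinimal], NoRationalTwoTorsion W → W.mordellWeilRank = 1 →
    W.analyticRank = 1 → shaTwoCard W = 4 →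
      ∃ q : ℚ, shaAn W = (q : ℂ) ∧
        (¬ ShaTwoInTwiceShaFour W → padicValRat 2 q = 2) ∧ (ShaTwoInTwiceShaFour W → 4 ≤ padicValRat 2 q)

/-- KERNEL weakening: CT ⇒ CT′. -/
theorem casselsTateBitAnalyticRankOne_of_casselsTateBit :
    ResidueCasselsTateBitAtTwo → ResidueCasselsTateBitAtTwoAnalyticRankOne :=
  fun h W _ _ hT hr _ h4 ↦ h W hT hr h4

end

end Summit.BirchSwinnertonDyer.Rank1Residual.F1Sign2
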